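import Literature.NumberTheory.PAdicHodge.BdRPlusLogLatticeKernel
import Literature.NumberTheory.PAdicHodge.TiltPowPadicInt
import HarnessLib

/-!
# `a · log[x] = log[x^a]` for `a ∈ ℤ_p`: the logarithms `log[x] mod Fil^k` form a `ℤ_p`-module

Topic `Literature/NumberTheory/PAdicHodge`; namespace `Literature.NumberTheory.PAdicHodge.GaloisContinuity`. THEOREMS ONLY (no definition,
no instance, no named fact, no `sorry`). Sequel of `BdRPlusLogLattice` (`IsLogModFil`), `BdRPlusLogLatticeMul` (`log` is additive,
`log((1+y)ⁿ) ≡ n·log(1+y)`), `BdRPlusLogLatticeKernel` (`[x] − 1 ∈ (p, ξ) ↔ ‖x♯ − 1‖ ≤ ‖p‖`) and `TiltPowPadicInt` (`x^a` in the tilt for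
`x₀ = 1`, `a ∈ ℤ_p`):

* §1 `p`-ADIC CONTINUITY IN THE ARGUMENT: `P_M(y) − P_M(y') ∈ Λ(j, k)` for ALL `M` as soon as `y − y' ∈ (p, ξ)^N`, `N ≥ 2(j+k) + 2`
  (`logPartialSum_sub_logPartialSum_mem_lattice`), hence ★ `IsLogModFil.of_approx`: `IsLogModFil k` is closed under simultaneous `p`-adic
  approximation of the argument (`(p, ξ)`-adically) and of the logarithm (in Fontaine's lattice topology).
* §2 TEICHMÜLLER ARGUMENTS: `[x] − 1 ∈ (p, ξ) ↔ x₀ = 1` (`teichmuller_sub_one_mem_span_p_xi_iff_coeff_zero`); `[x]^{p^N} − 1 ∈ (p,ξ)^{N+1}`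
  (`teichmuller_pow_prime_pow_sub_one_mem`); sums: `IsLogModFil.teichmuller_mul` (`log[x] + log[x'] = log[xx']`).
* §3 ★★ `IsLogModFil.teichmuller_tiltPow`: if `L` is a logarithm of `[x]` modulo `Fil^k` (`x₀ = 1`) then `a · L` is one of `[x^a]` for every
  `a ∈ ℤ_p` (`x^a = PreTilt.tiltPow x a`): approximate `a` by `v = a mod p^N`, `[x^a] = [x]^v · ([x^b])^{p^N} ≡ [x]^v (mod (p,ξ)^{N+1})`,
  `a·L − v·L = p^N b·L → 0`, and §1.

So the set `X⁰_k = {L : L a logarithm mod Fil^k of some [x], x₀ = 1}` is a `ℤ_p`-submodule of `B_dR⁺` containing `t` (`isLogModFil_uAinf_tBdR`),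
and `X_k = ℚ_p · X⁰_k = ⋃_m p^{-m} X⁰_k`; with `BdRPlusLogLatticeKernel` this is floor (H4)-2 of
`Summits/…/Cruxes/StarredOptimalManinUnitFiveSeven/Lines/kato-lever-K3-B2-road.md` (crux K★ `stmt-BirchSwinnertonDyer-22226`): `X₂ ∩ Fil¹ = ℚ_p t`,
`θ(X₂) = ℂ_F`. Infrastructure only; BSD / K★ are not proved by any of this.

## References
* J.-M. Fontaine, *Le corps des périodes p-adiques*, Astérisque 223 (1994), Exp. II §1.5.3–1.5.4. [FontaineAsterisque223III]
* J.-M. Fontaine, Y. Ouyang, *Theory of p-adic Galois representations*, §6.1 (`U = 1 + 𝔪_{ℂ♭}` as a `ℚ_p`-vector space, `log[·] : U → B_crys^{φ=p}`).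
  [FontaineOuyang2022]
-/

noncomputable section

namespace Literature.NumberTheory.PAdicHodge

namespace GaloisContinuity

open ValuativeRel Field Ideal WittVector Finset Filter TruncatedLog
open Literature.NumberTheory.GaloisRepresentations Literature.NumberTheory.GaloisRepresentations.IsNonarchimedeanLocalField

variable {F : Type} [Field F] [ValuativeRel F] [TopologicalSpace F] [IsNonarchimedeanLocalField F]
  [CharZero F] {p : ℕ} [Fact p.Prime] [Fact (¬ IsUnit (p : integerC F))]
  [IsAdicComplete (Ideal.span {(p : integerC F)}) (integerC F)]

/-! ## §1 `p`-adic continuity of `P_M` in the argument; `IsLogModFil` is closed under approximation -/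

/-- `yⁿ − y'ⁿ ∈ I^{N + (n − 1)}` when `y, y' ∈ I` and `y − y' ∈ I^N` (`yⁿ − y'ⁿ = (y − y') Σ yⁱ y'^{n−1−i}`). [folklore] -/
private theorem pow_sub_pow_mem_pow {R : Type*} [CommRing R] {I : Ideal R} {y y' : R} (hy : y ∈ I) (hy' : y' ∈ I) {N : ℕ}
    (h : y - y' ∈ I ^ N) (n : ℕ) : y ^ n - y' ^ n ∈ I ^ (N + (n - 1)) := by
  rw [← geom_sum₂_mul, add_comm, pow_add]
  refine Ideal.mul_mem_mul (Ideal.sum_mem _ fun i hi => ?_) h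
  have hi' := Finset.mem_range.1 hi
  have e : I ^ (n - 1) = I ^ i * I ^ (n - 1 - i) := by rw [← pow_add]; congr 1; omega
  rw [e]
  exact Ideal.mul_mem_mul (Ideal.pow_mem_pow hy _) (Ideal.pow_mem_pow hy' _)

omit [CharZero F] in
/-- ★ **`P_M` is `p`-adically continuous in its argument, uniformly in `M`**: for `y, y' ∈ (p, ξ)𝔸_inf` with `y − y' ∈ (p, ξ)^N`,
`N ≥ 2(j + k) + 2`, every `P_M(y) − P_M(y')` lies in `Λ(j, k)` (termwise: `c_n (yⁿ − y'ⁿ) ∈ c_n (p,ξ)^{N+n−1}`, and `v_p(n) ≤ n − 1`).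
[cite: FontaineAsterisque223III, Exp. II §1.5.3–1.5.4] -/
theorem logPartialSum_sub_logPartialSum_mem_lattice {y y' : Ainf (p := p) F} (hy : y ∈ Ideal.span {(p : Ainf (p := p) F), xi})
    (hy' : y' ∈ Ideal.span {(p : Ainf (p := p) F), xi}) {j k N : ℕ} (hN : 2 * (j + k) + 2 ≤ N)
    (h : y - y' ∈ Ideal.span {(p : Ainf (p := p) F), xi} ^ N) (M : ℕ) :
    ∃ (a : Ainf (p := p) F) (w : BDeRhamPlus (integerC F) p),
      logPartialSum y M - logPartialSum y' M = ainfToBdR ((p : Ainf (p := p) F) ^ j * a) + xiBdR ^ k * w := by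
  rw [logPartialSum_eq_aeval_logTrunc, logPartialSum_eq_aeval_logTrunc, aeval_logTrunc, aeval_logTrunc, ← Finset.sum_sub_distrib]
  refine lattice_sum _ fun m hm => ?_
  rw [← mul_sub, ← map_pow, ← map_pow, ← map_sub]
  -- `y^{m+1} − y'^{m+1} ∈ (p,ξ)^{N+m} ⊆ (p,ξ)^{M'+1}` with `M' = m + 2(j+k) + 1`
  have hw : y ^ (m + 1) - y' ^ (m + 1) ∈ Ideal.span {(p : Ainf (p := p) F), xi} ^ ((m + 2 * (j + k) + 1) + 1) :=
    Ideal.pow_le_pow_right (by omega) (pow_sub_pow_mem_pow hy hy' h (m + 1))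
  exact algebraMap_coeff_mul_ainfToBdR_mem_lattice (by omega) (by omega) hw

omit [CharZero F] in
/-- ★ **`IsLogModFil` is closed under `p`-adic approximation.** If for every `j` there are `y' ∈ (p,ξ)` and a logarithm `L'` of `1 + y'`
modulo `Fil^k` with `y' ≡ y (mod (p,ξ)^{2(j+k)+2})` and `L' ≡ L (mod Λ(j, k))`, then `L` is a logarithm of `1 + y` modulo `Fil^k`.
[cite: FontaineAsterisque223III, Exp. II §1.5.3–1.5.4] -/
theorem IsLogModFil.of_approx {k : ℕ} {y : Ainf (p := p) F} (hy : y ∈ Ideal.span {(p : Ainf (p := p) F), xi})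
    {L : BDeRhamPlus (integerC F) p}
    (h : ∀ j : ℕ, ∃ (y' : Ainf (p := p) F) (L' : BDeRhamPlus (integerC F) p), y' ∈ Ideal.span {(p : Ainf (p := p) F), xi} ∧
      IsLogModFil k y' L' ∧ y' - y ∈ Ideal.span {(p : Ainf (p := p) F), xi} ^ (2 * (j + k) + 2) ∧
      ∃ (a : Ainf (p := p) F) (w : BDeRhamPlus (integerC F) p), L' - L = ainfToBdR ((p : Ainf (p := p) F) ^ j * a) + xiBdR ^ k * w) :
    IsLogModFil k y L := by
  intro j
  obtain ⟨y', L', hy', hL', hyy', a, w, hLL'⟩ := h j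
  obtain ⟨M₀, hM₀⟩ := hL' j
  refine ⟨M₀, fun M hM => ?_⟩
  obtain ⟨a₁, w₁, h1⟩ := hM₀ M hM
  obtain ⟨a₂, w₂, h2⟩ := logPartialSum_sub_logPartialSum_mem_lattice hy' hy le_rfl hyy' M
  refine ⟨a₁ - a + a₂, w₁ - w + w₂, ?_⟩
  have e : L - logPartialSum y M = (L' - logPartialSum y' M) - (L' - L) + (logPartialSum y' M - logPartialSum y M) := by ring
  rw [e]
  exact lattice_add (lattice_sub h1 hLL') h2

/-! ## §2 Teichmüller arguments -/

omit [CharZero F] [Fact (¬ IsUnit (p : integerC F))] [IsAdicComplete (Ideal.span {(p : integerC F)}) (integerC F)]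
  [ValuativeRel F] [TopologicalSpace F] [IsNonarchimedeanLocalField F] [Fact p.Prime] in
/-- `(1 + w)^{p^N} − 1 ∈ I^{N+1}` for `w ∈ I` when `p ∈ I` (`(1+u)^p − 1 = u(p + u s)`). [folklore] -/
private theorem one_add_pow_prime_pow_sub_one_mem {R : Type*} [CommRing R] {I : Ideal R} (hp : (p : R) ∈ I) {w : R} (hw : w ∈ I)
    (N : ℕ) : (1 + w) ^ p ^ N - 1 ∈ I ^ (N + 1) := by
  induction N with
  | zero => simp only [pow_zero, pow_one, zero_add, add_sub_cancel_left]; exact hw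
  | succ N ih =>
    set u : R := (1 + w) ^ p ^ N - 1 with hu
    have e1 : (1 + w) ^ p ^ (N + 1) = (1 + u) ^ p := by rw [pow_succ, pow_mul, hu, add_sub_cancel]
    -- `Σ_{i<p} (1+u)^i = p + u s`
    have hdvd : u ∣ (∑ i ∈ range p, (1 + u) ^ i) - p := by
      have e2 : (∑ i ∈ range p, (1 + u) ^ i) - (p : R) = ∑ i ∈ range p, ((1 + u) ^ i - 1) := by
        rw [Finset.sum_sub_distrib, Finset.sum_const, Finset.card_range, nsmul_eq_mul, mul_one]
      rw [e2]
      exact Finset.dvd_sum fun i _ => by simpa using sub_dvd_pow_sub_pow (1 + u) 1 i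
    obtain ⟨s, hs⟩ := hdvd
    have e3 : (1 + u) ^ p - 1 = (p : R) * u + u * u * s := by
      have h := geom_sum_mul (1 + u) p
      rw [add_sub_cancel_left] at h
      rw [← h, show (∑ i ∈ range p, (1 + u) ^ i) = p + u * s by rw [← hs]; ring]
      ring
    rw [e1, e3]
    refine add_mem ?_ ?_
    · rw [pow_succ']; exact Ideal.mul_mem_mul hp ih
    · rw [show N + 1 + 1 = (N + 1) + 1 by rfl, pow_succ]
      exact Ideal.mul_mem_right _ _ (Ideal.mul_mem_mul ih (Ideal.pow_le_self (Nat.succ_ne_zero N) ih))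

/-- **`[x] − 1 ∈ (p, ξ)𝔸_inf ↔ x₀ = 1`** (`θ([x]) = x♯ ≡ x₀ (mod p)`; `(p, ξ) = θ⁻¹(p𝒪_{ℂ_F})`). [cite: FontaineAsterisque223III, Exp. II §1.2.2–1.2.3] -/
theorem teichmuller_sub_one_mem_span_p_xi_iff_coeff_zero (x : PreTilt (integerC F) p) :
    (teichmuller p x : Ainf (p := p) F) - 1 ∈ Ideal.span {(p : Ainf (p := p) F), xi} ↔ PreTilt.coeff 0 x = 1 := by
  rw [← PreTilt.mk_untilt_eq_coeff_zero, ← map_one (Ideal.Quotient.mk (Ideal.span {(p : integerC F)})), Ideal.Quotient.eq,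
    Ideal.mem_span_singleton']
  constructor
  · intro h
    obtain ⟨a, b, hab⟩ := Ideal.mem_span_pair.1 h
    refine ⟨fontaineTheta (integerC F) p a, ?_⟩
    have h1 := congrArg (fontaineTheta (integerC F) p) hab
    rw [map_add, map_mul, map_mul, map_natCast, fontaineTheta_xi, mul_zero, add_zero, map_sub, map_one,
      fontaineTheta_teichmuller] at h1
    exact h1
  · rintro ⟨c, hc⟩
    rw [teichmuller_sub_one_mem_span_p_xi_iff]
    have h1 := congrArg (fun z : integerC F => (z : CompletedAlgClosure F)) hc
    push_cast at h1
    rw [← h1, norm_mul]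
    exact mul_le_of_le_one_left (norm_nonneg _) (norm_coe_integerC_le _)

/-- **`[w]^{p^N} − 1 ∈ (p, ξ)^{N+1}`** for `w₀ = 1` (`[w] ≡ 1 (mod (p,ξ))` and `p ∈ (p, ξ)`): `p`-adic smallness of high `p`-power
Teichmüller representatives. [cite: FontaineAsterisque223III, Exp. II §1.5.3] -/
theorem teichmuller_pow_prime_pow_sub_one_mem {w : PreTilt (integerC F) p} (hw : PreTilt.coeff 0 w = 1) (N : ℕ) :
    (teichmuller p w : Ainf (p := p) F) ^ p ^ N - 1 ∈ Ideal.span {(p : Ainf (p := p) F), xi} ^ (N + 1) := by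
  have h := one_add_pow_prime_pow_sub_one_mem (I := Ideal.span {(p : Ainf (p := p) F), xi})
    (Ideal.subset_span (Set.mem_insert _ _)) ((teichmuller_sub_one_mem_span_p_xi_iff_coeff_zero w).2 hw) N
  rwa [add_sub_cancel] at h

/-- **Sums**: if `L, L'` are logarithms of `[x], [x']` modulo `Fil^k` (`x₀ = x'₀ = 1`), then `L + L'` is one of `[x x']`
(`IsLogModFil.add`; `[·]` is multiplicative). [cite: FontaineOuyang2022, §6.1] -/
theorem IsLogModFil.teichmuller_mul {k : ℕ} {x x' : PreTilt (integerC F) p} (hx : PreTilt.coeff 0 x = 1) (hx' : PreTilt.coeff 0 x' = 1)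
    {L L' : BDeRhamPlus (integerC F) p} (hL : IsLogModFil k ((teichmuller p x : Ainf (p := p) F) - 1) L)
    (hL' : IsLogModFil k ((teichmuller p x' : Ainf (p := p) F) - 1) L') :
    IsLogModFil k ((teichmuller p (x * x') : Ainf (p := p) F) - 1) (L + L') := by
  have h := hL.add ((teichmuller_sub_one_mem_span_p_xi_iff_coeff_zero x).2 hx)
    ((teichmuller_sub_one_mem_span_p_xi_iff_coeff_zero x').2 hx') hL'
  rwa [show ((teichmuller p x : Ainf (p := p) F) - 1) + ((teichmuller p x' : Ainf (p := p) F) - 1) +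
      ((teichmuller p x : Ainf (p := p) F) - 1) * ((teichmuller p x' : Ainf (p := p) F) - 1) =
      (teichmuller p (x * x') : Ainf (p := p) F) - 1 by rw [map_mul]; ring] at h

/-! ## §3 `a · log[x]` is a logarithm of `[x^a]`, `a ∈ ℤ_p` -/

/-- ★★ **`a · log[x] = log[x^a]` modulo `Fil^k` for `a ∈ ℤ_p`.** If `L` is a logarithm of `[x]` modulo `Fil^k` (`x₀ = 1`), then `a · L` is a
logarithm of `[x^a]` (`x^a = PreTilt.tiltPow x a`): with `v = a mod p^N`, `a = v + p^N b`, the logarithm `v · L` of `[x]^v`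
(`IsLogModFil.pow_sub_one`) approximates `a · L` in `Λ(N − r, k)` and `[x]^v` approximates `[x^a] = [x]^v ([x^b])^{p^N}` modulo
`(p, ξ)^{N+1}`; conclude by `IsLogModFil.of_approx`. Hence the logarithms of Teichmüller representatives modulo `Fil^k` form a `ℤ_p`-module.
[cite: FontaineOuyang2022, §6.1] [cite: FontaineAsterisque223III, Exp. II §1.5.4] -/
theorem IsLogModFil.teichmuller_tiltPow {k : ℕ} {x : PreTilt (integerC F) p} (hx : PreTilt.coeff 0 x = 1)
    {L : BDeRhamPlus (integerC F) p} (hL : IsLogModFil k ((teichmuller p x : Ainf (p := p) F) - 1) L) (a : ℤ_[p]) :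
    IsLogModFil k ((teichmuller p (PreTilt.tiltPow x a) : Ainf (p := p) F) - 1) (qpToBdR (a : ℚ_[p]) * L) := by
  have hxI := (teichmuller_sub_one_mem_span_p_xi_iff_coeff_zero x).2 hx
  have haI := (teichmuller_sub_one_mem_span_p_xi_iff_coeff_zero (PreTilt.tiltPow x a)).2 (PreTilt.coeff_zero_tiltPow x a)
  obtain ⟨r, a₀, w₀, hbd⟩ := exists_natCast_pow_mul_eq_ainfToBdR_add L k
  refine IsLogModFil.of_approx haI fun j => ?_
  -- the precision `N`, `v = a mod p^N`, `a = v + p^N b`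
  obtain ⟨N, hN1, hN2⟩ : ∃ N : ℕ, 2 * (j + k) + 2 ≤ N ∧ j + r ≤ N := ⟨2 * (j + k) + 2 + (j + r), by omega, by omega⟩
  haveI : NeZero (p ^ N) := ⟨pow_ne_zero _ (Fact.out : p.Prime).ne_zero⟩
  set v : ℕ := (PadicInt.toZModPow N a).val with hv
  have hker : a - (v : ℤ_[p]) ∈ RingHom.ker (PadicInt.toZModPow N) := by
    rw [RingHom.mem_ker, map_sub, map_natCast, hv, ZMod.natCast_zmod_val, sub_self]
  rw [PadicInt.ker_toZModPow] at hker
  obtain ⟨b, hb⟩ := Ideal.mem_span_singleton'.1 hker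
  have hab : a = (v : ℤ_[p]) + (p : ℤ_[p]) ^ N * b := by linear_combination -hb
  refine ⟨(teichmuller p x : Ainf (p := p) F) ^ v - 1, (v : BDeRhamPlus (integerC F) p) * L, ?_, ?_, ?_, ?_⟩
  · -- `[x]^v − 1 ∈ (p, ξ)`
    obtain ⟨c, hc⟩ := sub_dvd_pow_sub_pow (teichmuller p x : Ainf (p := p) F) 1 v
    rw [one_pow] at hc
    rw [hc]
    exact Ideal.mul_mem_right _ _ hxI
  · -- `v · L` is a logarithm of `[x]^v`
    have h := hL.pow_sub_one hxI v
    rwa [add_sub_cancel, nsmul_eq_mul] at h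
  · -- `[x]^v ≡ [x^a] (mod (p, ξ)^{N+1})`
    have e : (teichmuller p x : Ainf (p := p) F) ^ v - 1 - ((teichmuller p (PreTilt.tiltPow x a) : Ainf (p := p) F) - 1) =
        -((teichmuller p x : Ainf (p := p) F) ^ v * ((teichmuller p (PreTilt.tiltPow x b) : Ainf (p := p) F) ^ p ^ N - 1)) := by
      rw [PreTilt.tiltPow_eq_pow_mul_pow hx hab, map_mul, map_pow, map_pow]; ring
    rw [e]
    exact neg_mem (Ideal.pow_le_pow_right (by omega)
      (Ideal.mul_mem_left _ _ (teichmuller_pow_prime_pow_sub_one_mem (PreTilt.coeff_zero_tiltPow x b) N)))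
  · -- `v · L − a · L = −p^N b · L ∈ Λ(N − r, k) ⊆ Λ(j, k)`
    obtain ⟨i, hi⟩ := Nat.exists_eq_add_of_le hN2
    have hδ : ((v : ℚ_[p]) - (a : ℚ_[p])) = (p : ℚ_[p]) ^ ((j + i) + r) * ((-b : ℤ_[p]) : ℚ_[p]) := by
      rw [hab, show j + i + r = N by omega]
      push_cast
      ring
    obtain ⟨a', w', h'⟩ := lattice_smul_of_bounded hbd hδ
    have e2 : (v : BDeRhamPlus (integerC F) p) * L - qpToBdR (a : ℚ_[p]) * L = qpToBdR ((v : ℚ_[p]) - (a : ℚ_[p])) * L := by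
      rw [map_sub, map_natCast, sub_mul]
    rw [e2]
    exact lattice_mono (Nat.le_add_right j i) le_rfl h'

end GaloisContinuity

end Literature.NumberTheory.PAdicHodge

end
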